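import Literature.Geometry.Riemannian.ExpMapEnergyTaylor
import Literature.Geometry.Riemannian.RicciFlowScalarCurvatureRegularity
import Literature.MeasureTheory.Integral.IteratedIntegralDiracLimit
import Mathlib.Analysis.Calculus.MeanValue
import HarnessLib

/-!
# The squared distance under a Ricci flow has the one-sided first-order upper bound
# `d_{t′}²(x, y) ≤ d_t²(x, y) + (−2d ∫₀ᵈ Ric_t(γ̇, γ̇) − ε)(t′ − t)` for `t′ < t` near `t`
# (the time part of Bamler 2020a, Thm. 3.5: `∂ₜ d_t² ≥ −2d ∫ Ric(γ′, γ′)`, as a left barrier)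

R. Bamler, *Entropy and heat kernel bounds on a Ricci flow background*, arXiv:2008.07093 (2020a),
proof of Thm. 3.5: "`∂ₜ d_t²(x, y) ≥ −2d ∫₀ᵈ Ric(γ′(s), γ′(s)) ds`" for a minimising unit speed
`g_t`-geodesic `γ` from `x` to `y`. We prove the statement in the form of a LEFT TAYLOR UPPER
BARRIER (the shape consumed by the directional minimum principle,
`DirectionalBarrierMinimumPrinciple.lean`), for any smooth curve `γ` from `x` to `y` of
`g_t`-unit speed and length `d = d_t(x, y)`:

* `contMDiff_val_family_along` — `(s, τ) ↦ g_τ(γ̇(s), γ̇(s))` is `C^∞` for a smooth global family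
  and a smooth curve (`ContMDiffAt.clm_bundle_apply₂`);
* `edist_toReal_sq_le_mul_integral_val_velocity` — `d(x, y)² ≤ T ∫₀ᵀ g(γ̇, γ̇)` for a smooth curve
  from `x = γ(0)` to `y = γ(T)` (distance ≤ length, Cauchy–Schwarz);
* `IsRicciFlow.edist_toReal_sq_le_taylor_left` — for every `ε > 0`, for `t′ < t` close to `t`,
  `d_{t′}(x, y)² ≤ d_t(x, y)² + (−2T ∫₀ᵀ Ric_t(γ̇, γ̇) − ε)(t′ − t)`: the energy
  `E(τ) = T ∫₀ᵀ g_τ(γ̇, γ̇)` dominates `d_τ²` (all `τ`), equals `T² = d_t²` at `τ = t`, and is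
  differentiable at `t` with `E′(t) = −2T ∫ Ric_t(γ̇, γ̇)` (the flow equation `∂ₜg = −2Ric` within
  the time set, identified with the two-sided derivative of the smooth global family, and a
  uniform first-order Taylor estimate from the joint continuity of `∂_τ g_τ(γ̇, γ̇)`).

Everything is proved; no definitions, no named facts.

## References

* R. H. Bamler, *Entropy and heat kernel bounds on a Ricci flow background*, arXiv:2008.07093
  (2020), §3.2, proof of Thm. 3.5 (display (3.8)). [Bamler2020Entropy]
-/

noncomputable section

open Bundle Set Function Filter Manifold MeasureTheory TopologicalSpace intervalIntegral
open scoped Manifold ContDiff Topology ENNReal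

namespace Literature.Geometry.Riemannian

open Lorentzian Lorentzian.PseudoRiemannianMetric Literature.MeasureTheory.Integral

section TimeTaylor

variable {E : Type*} [NormedAddCommGroup E] [NormedSpace ℝ E] [FiniteDimensional ℝ E]
  [CompleteSpace E] {H : Type*} [TopologicalSpace H] {I : ModelWithCorners ℝ E H}
  {M : Type*} [TopologicalSpace M] [ChartedSpace H M] [IsManifold I ∞ M]
  {h : ℝ → PseudoRiemannianMetric I ∞ E (TangentSpace I : M → Type _)}

omit [FiniteDimensional ℝ E] [CompleteSpace E] in
/-- **`(s, τ) ↦ g_τ(γ̇(s), γ̇(s))` is `C^∞`** for a `C^∞` global family of metrics and a `C^∞` curve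
(Mathlib's `ContMDiffAt.clm_bundle_apply₂` over the base map `(s, τ) ↦ γ s`). [folklore] -/
theorem contMDiff_val_family_along (hh : IsContMDiffFamilyOn ∞ h univ) {γ : ℝ → M}
    (hγ : ContMDiff 𝓘(ℝ, ℝ) I ∞ γ) :
    ContMDiff (𝓘(ℝ, ℝ).prod 𝓘(ℝ, ℝ)) 𝓘(ℝ, ℝ) ∞
      (fun q : ℝ × ℝ ↦ (h q.2).val (γ q.1) (velocity I γ q.1) (velocity I γ q.1)) := by
  intro q
  have hbase : ContMDiffAt (𝓘(ℝ, ℝ).prod 𝓘(ℝ, ℝ)) (I.prod 𝓘(ℝ, ℝ)) ∞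
      (fun q : ℝ × ℝ ↦ ((γ q.1, q.2) : M × ℝ)) q :=
    (hγ.contMDiffAt.comp q contMDiffAt_fst).prodMk contMDiffAt_snd
  have hψ : ContMDiffAt (𝓘(ℝ, ℝ).prod 𝓘(ℝ, ℝ)) (I.prod 𝓘(ℝ, E →L[ℝ] E →L[ℝ] ℝ)) ∞
      (fun q : ℝ × ℝ ↦ TotalSpace.mk' (E →L[ℝ] E →L[ℝ] ℝ) (E := fun b : M ↦
        TangentSpace I b →L[ℝ] TangentSpace I b →L[ℝ] ℝ) (γ q.1) ((h q.2).val (γ q.1))) q := by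
    have h1 : ContMDiffAt (I.prod 𝓘(ℝ, ℝ)) (I.prod 𝓘(ℝ, E →L[ℝ] E →L[ℝ] ℝ)) ∞
        (fun p : M × ℝ ↦ TotalSpace.mk' (E →L[ℝ] E →L[ℝ] ℝ) (E := fun b : M ↦
          TangentSpace I b →L[ℝ] TangentSpace I b →L[ℝ] ℝ) p.1 ((h p.2).val p.1)) (γ q.1, q.2) := by
      have := hh (γ q.1, q.2) ⟨mem_univ _, mem_univ _⟩
      rwa [univ_prod_univ, contMDiffWithinAt_univ] at this
    exact h1.comp q hbase
  have hv : ContMDiffAt (𝓘(ℝ, ℝ).prod 𝓘(ℝ, ℝ)) (I.prod 𝓘(ℝ, E)) ∞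
      (fun q : ℝ × ℝ ↦ (⟨γ q.1, velocity I γ q.1⟩ : TangentBundle I M)) q :=
    ((contMDiff_lift_velocity_of_contMDiff (I := I) hγ) q.1).comp q contMDiffAt_fst
  have key : ContMDiffAt (𝓘(ℝ, ℝ).prod 𝓘(ℝ, ℝ)) (I.prod 𝓘(ℝ, ℝ)) ∞
      (fun q : ℝ × ℝ ↦ TotalSpace.mk' ℝ (E := Bundle.Trivial M ℝ) (γ q.1)
        ((h q.2).val (γ q.1) (velocity I γ q.1) (velocity I γ q.1))) q := by
    apply ContMDiffAt.clm_bundle_apply₂ (F₁ := E) (F₂ := E)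
    · exact hψ
    · exact hv
    · exact hv
  rw [contMDiffAt_totalSpace] at key
  exact key.2

omit [CompleteSpace E] in
/-- **`d(x, y)² ≤ T ∫₀ᵀ g(γ̇, γ̇)`** for a `C^∞` curve `γ` with `γ 0 = x`, `γ T = y`, `T ≥ 0`
(distance ≤ length, `edist_le_length`; Cauchy–Schwarz,
`sq_intervalIntegral_le_length_mul_of_continuous`). [folklore] -/
theorem edist_toReal_sq_le_mul_integral_val_velocity
    (g : PseudoRiemannianMetric I ∞ E (TangentSpace I : M → Type _)) (hg : g.IsRiemannian)
    {γ : ℝ → M} (hγ : ContMDiff 𝓘(ℝ, ℝ) I ∞ γ) {T : ℝ} (hT : 0 ≤ T) :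
    g.edist hg (γ 0) (γ T) ≠ ⊤ ∧
      (g.edist hg (γ 0) (γ T)).toReal ^ 2 ≤
        T * ∫ s in (0 : ℝ)..T, g.val (γ s) (velocity I γ s) (velocity I γ s) := by
  haveI : Fact ((1 : ℕ∞ω) ≤ (∞ : ℕ∞ω)) := ⟨by exact_mod_cast le_top⟩
  have hnn : ∀ (y : M) (v' : TangentSpace I y), 0 ≤ g.val y v' v' := fun y v' ↦ by
    by_cases hv : v' = 0
    · subst hv; simp
    · exact (hg y v' hv).le
  have hTl := contMDiff_lift_velocity_of_contMDiff (I := I) hγ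
  have hsm : ContMDiff 𝓘(ℝ, ℝ) 𝓘(ℝ, ℝ) ∞ (fun s ↦ g.val (γ s) (velocity I γ s) (velocity I γ s)) :=
    fun s ↦ contMDiffAt_val_apply_along g le_rfl (hTl s) (hTl s)
  have hfc : Continuous fun s ↦ g.val (γ s) (velocity I γ s) (velocity I γ s) := hsm.continuous
  have h1le : (1 : ℕ∞ω) ≤ (∞ : ℕ∞ω) := by exact_mod_cast le_top
  have hc₁ : ContMDiffOn 𝓘(ℝ, ℝ) I 1 γ (Icc 0 T) := (hγ.of_le h1le).contMDiffOn
  have hd : g.edist hg (γ 0) (γ T) ≤ g.length hg γ 0 T := g.edist_le_length hg hT hc₁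
  have hL := length_eq_ofReal_integral g hg hT hfc
  have hℓ : 0 ≤ ∫ s in (0 : ℝ)..T, Real.sqrt (g.val (γ s) (velocity I γ s) (velocity I γ s)) :=
    intervalIntegral.integral_nonneg hT fun s _ ↦ Real.sqrt_nonneg _
  rw [hL] at hd
  refine ⟨ne_top_of_le_ne_top ENNReal.ofReal_ne_top hd, ?_⟩
  have hdr : (g.edist hg (γ 0) (γ T)).toReal ≤
      ∫ s in (0 : ℝ)..T, Real.sqrt (g.val (γ s) (velocity I γ s) (velocity I γ s)) :=
    ENNReal.toReal_le_of_le_ofReal hℓ hd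
  have hsc : Continuous fun s ↦ Real.sqrt (g.val (γ s) (velocity I γ s) (velocity I γ s)) :=
    Real.continuous_sqrt.comp hfc
  have hCS := sq_intervalIntegral_le_length_mul_of_continuous hsc hT
  have hsq : (fun s ↦ Real.sqrt (g.val (γ s) (velocity I γ s) (velocity I γ s)) ^ 2) =
      fun s ↦ g.val (γ s) (velocity I γ s) (velocity I γ s) :=
    funext fun s ↦ Real.sq_sqrt (hnn _ _)
  rw [hsq, sub_zero] at hCS
  exact (pow_le_pow_left₀ ENNReal.toReal_nonneg hdr 2).trans hCS

variable {cov : ℝ → CovariantDerivative I E (TangentSpace I : M → Type _)}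

/-- **Left first-order Taylor upper barrier for `d_t²` under a Ricci flow** (the time part of
Bamler 2020a, Thm. 3.5, `∂ₜ d_t² ≥ −2d ∫ Ric(γ′, γ′)`). Let `h` be a `C^∞` global family of
Riemannian metrics which is a Ricci flow on the order-connected time set `S`, `t ∈ S` not the
initial time, and `γ` a `C^∞` curve with `γ 0 = x`, `γ T = y`, `T = d_t(x, y) > 0`, of
`h(t)`-unit speed on `[0, T]`. Then for every `ε > 0`, for `t′ < t` close to `t`,
`d_{t′}(x, y)² ≤ d_t(x, y)² + (−2T ∫₀ᵀ Ric_t(γ̇, γ̇) − ε)(t′ − t)`.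
[cite: Bamler2020Entropy, §3.2, proof of Thm. 3.5] -/
theorem IsRicciFlow.edist_toReal_sq_le_taylor_left (hh : IsContMDiffFamilyOn ∞ h univ)
    (hR : ∀ r, (h r).IsRiemannian) {S : Set ℝ} (hS : S.OrdConnected) (hflow : IsRicciFlow h cov S)
    {t : ℝ} (ht : t ∈ S) (hleft : ∃ s ∈ S, s < t)
    {γ : ℝ → M} (hγ : ContMDiff 𝓘(ℝ, ℝ) I ∞ γ) {T : ℝ} (hT : 0 < T)
    (hspeed : ∀ s ∈ Icc (0 : ℝ) T, (h t).val (γ s) (velocity I γ s) (velocity I γ s) = 1)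
    (hdist : ((h t).edist (hR t) (γ 0) (γ T)).toReal = T) :
    ∀ ε > 0, ∀ᶠ t' in 𝓝[<] t,
      ((h t').edist (hR t') (γ 0) (γ T)).toReal ^ 2 ≤
        ((h t).edist (hR t) (γ 0) (γ T)).toReal ^ 2 +
          (-(2 * T * ∫ s in (0 : ℝ)..T, (cov t).ricci (γ s) (velocity I γ s) (velocity I γ s)) - ε) *
            (t' - t) := by
  intro ε hε
  -- the smooth function `G(s, τ) = g_τ(γ̇ s, γ̇ s)` and its `τ`-derivative
  set G : ℝ × ℝ → ℝ := fun q ↦ (h q.2).val (γ q.1) (velocity I γ q.1) (velocity I γ q.1) with hG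
  have hGs : ContDiff ℝ ∞ G := by
    have hfst : ContMDiff 𝓘(ℝ, ℝ × ℝ) 𝓘(ℝ, ℝ) ∞ (Prod.fst : ℝ × ℝ → ℝ) :=
      contMDiff_iff_contDiff.2 contDiff_fst
    have hsnd : ContMDiff 𝓘(ℝ, ℝ × ℝ) 𝓘(ℝ, ℝ) ∞ (Prod.snd : ℝ × ℝ → ℝ) :=
      contMDiff_iff_contDiff.2 contDiff_snd
    exact contMDiff_iff_contDiff.1 ((contMDiff_val_family_along hh hγ).comp (hfst.prodMk hsnd))
  have hGd : ∀ q, HasFDerivAt G (fderiv ℝ G q) q := fun q ↦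
    (hGs.differentiable (by simp) q).hasFDerivAt
  set G₁ : ℝ × ℝ → ℝ := fun q ↦ fderiv ℝ G q (0, 1) with hG₁
  have hG₁c : Continuous G₁ :=
    (hGs.continuous_fderiv (by simp)).clm_apply continuous_const
  have hGτ : ∀ s τ, HasDerivAt (fun τ' ↦ G (s, τ')) (G₁ (s, τ)) τ := by
    intro s τ
    exact (hGd (s, τ)).comp_hasDerivAt τ ((hasDerivAt_const τ s).prodMk (hasDerivAt_id τ))
  -- at `τ = t` the derivative is `−2 Ric_t(γ̇, γ̇)` (flow equation within `S`, uniqueness)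
  obtain ⟨s₀, hs₀S, hs₀t⟩ := hleft
  have hU : UniqueDiffWithinAt ℝ S t :=
    (uniqueDiffOn_Icc hs₀t t (right_mem_Icc.2 hs₀t.le)).mono_nhds
      (nhdsWithin_mono _ (hS.out hs₀S ht))
  have hG₁t : ∀ s, G₁ (s, t) = -2 * (cov t).ricci (γ s) (velocity I γ s) (velocity I γ s) := by
    intro s
    exact hU.eq_deriv S (hGτ s t).hasDerivWithinAt
      (hflow.hasDerivWithinAt t ht (γ s) (velocity I γ s) (velocity I γ s))
  -- uniform continuity of `G₁` on `[0, T] × {t}` (tube lemma)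
  have hε' : 0 < ε / (T ^ 2 + 1) := by positivity
  have htube : ∀ᶠ τ in 𝓝 t, ∀ s : Icc (0 : ℝ) T, |G₁ ((s : ℝ), τ) - G₁ ((s : ℝ), t)| < ε / (T ^ 2 + 1) := by
    have hc : Continuous fun q : Icc (0 : ℝ) T × ℝ ↦ G₁ ((q.1 : ℝ), q.2) :=
      hG₁c.comp ((continuous_subtype_val.comp continuous_fst).prodMk continuous_snd)
    exact eventually_forall_abs_sub_lt (Φ := fun q : Icc (0 : ℝ) T × ℝ ↦ G₁ ((q.1 : ℝ), q.2)) hc t hε'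
  -- pointwise first-order bound for `t' < t` close to `t`
  obtain ⟨δ, hδ, hδ'⟩ := Metric.eventually_nhds_iff.1 htube
  have hpt : ∀ t' ∈ Ioo (t - δ) t, ∀ s ∈ Icc (0 : ℝ) T,
      G (s, t') ≤ G (s, t) + (t' - t) * G₁ (s, t) + ε / (T ^ 2 + 1) * (t - t') := by
    intro t' ht' s hs
    -- `f(τ) = G(s, τ) − τ G₁(s, t)` has `|f′| ≤ ε'` on `[t', t]`
    have hf : ∀ τ ∈ Icc t' t, HasDerivWithinAt (fun τ ↦ G (s, τ) - τ * G₁ (s, t))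
        (G₁ (s, τ) - G₁ (s, t)) (Icc t' t) τ := fun τ _ ↦
      ((hGτ s τ).sub ((hasDerivAt_id τ).mul_const (G₁ (s, t)))).hasDerivWithinAt |>.congr_deriv (by simp)
    have hbound : ∀ τ ∈ Ico t' t, ‖G₁ (s, τ) - G₁ (s, t)‖ ≤ ε / (T ^ 2 + 1) := by
      intro τ hτ
      have hτd : dist τ t < δ := by
        rw [Real.dist_eq, abs_sub_comm, abs_of_nonneg (by linarith [hτ.2])]; linarith [hτ.1, ht'.1]
      exact (Real.norm_eq_abs _).le.trans ((hδ' hτd ⟨s, hs⟩).le)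
    have key := norm_image_sub_le_of_norm_deriv_le_segment' hf hbound t (right_mem_Icc.2 ht'.2.le)
    rw [Real.norm_eq_abs] at key
    obtain ⟨h1, -⟩ := abs_le.1 key
    nlinarith [h1]
  -- integrate over `s ∈ [0, T]`
  have hGc : ∀ τ, Continuous fun s ↦ G (s, τ) := fun τ ↦
    hGs.continuous.comp (continuous_id.prodMk continuous_const)
  have hG₁c' : Continuous fun s ↦ G₁ (s, t) := hG₁c.comp (continuous_id.prodMk continuous_const)
  have hint_t : ∫ s in (0 : ℝ)..T, G (s, t) = T := by
    rw [intervalIntegral.integral_congr (g := fun _ ↦ (1 : ℝ)) (fun s hs ↦ ?_)]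
    · simp
    · rw [uIcc_of_le hT.le] at hs; exact hspeed s hs
  have hint_G₁ : ∫ s in (0 : ℝ)..T, G₁ (s, t) =
      -2 * ∫ s in (0 : ℝ)..T, (cov t).ricci (γ s) (velocity I γ s) (velocity I γ s) := by
    rw [← intervalIntegral.integral_const_mul]
    exact intervalIntegral.integral_congr fun s _ ↦ hG₁t s
  have hI : ∀ t' ∈ Ioo (t - δ) t, ∫ s in (0 : ℝ)..T, G (s, t') ≤
      T + (t' - t) * (-2 * ∫ s in (0 : ℝ)..T, (cov t).ricci (γ s) (velocity I γ s) (velocity I γ s)) +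
        ε / (T ^ 2 + 1) * (t - t') * T := by
    intro t' ht'
    have hi1 : IntervalIntegrable (fun s ↦ G (s, t')) volume 0 T := (hGc t').intervalIntegrable _ _
    have hi2 : IntervalIntegrable (fun s ↦ G (s, t)) volume 0 T := (hGc t).intervalIntegrable _ _
    have hi3 : IntervalIntegrable (fun s ↦ (t' - t) * G₁ (s, t)) volume 0 T :=
      (continuous_const.mul hG₁c').intervalIntegrable _ _
    have hi4 : IntervalIntegrable (fun _ : ℝ ↦ ε / (T ^ 2 + 1) * (t - t')) volume 0 T :=
      intervalIntegrable_const
    have h1 := intervalIntegral.integral_mono_on hT.le hi1 ((hi2.add hi3).add hi4)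
      (fun s hs ↦ hpt t' ht' s hs)
    rw [intervalIntegral.integral_add (hi2.add hi3) hi4, intervalIntegral.integral_add hi2 hi3,
      intervalIntegral.integral_const_mul, intervalIntegral.integral_const, hint_t, hint_G₁] at h1
    simp only [sub_zero, smul_eq_mul] at h1
    linarith
  -- distance at time `t'` versus the energy at time `t'`
  have hdom : ∀ t', ((h t').edist (hR t') (γ 0) (γ T)).toReal ^ 2 ≤ T * ∫ s in (0 : ℝ)..T, G (s, t') :=
    fun t' ↦ (edist_toReal_sq_le_mul_integral_val_velocity (h t') (hR t') hγ hT.le).2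
  -- assemble
  have hmem : Ioo (t - δ) t ∈ 𝓝[<] t := Ioo_mem_nhdsLT (by linarith)
  filter_upwards [hmem] with t' ht'
  have h1 := hdom t'
  have h2 := hI t' ht'
  rw [hdist]
  have hTt : 0 ≤ T * (t - t') := mul_nonneg hT.le (by linarith [ht'.2])
  have h3 : T * (ε / (T ^ 2 + 1) * (t - t') * T) ≤ ε * (t - t') := by
    have : T * (ε / (T ^ 2 + 1) * (t - t') * T) = ε * (t - t') * (T ^ 2 / (T ^ 2 + 1)) := by
      field_simp
    rw [this]
    have h4 : T ^ 2 / (T ^ 2 + 1) ≤ 1 := by rw [div_le_one (by positivity)]; linarith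
    have h5 : 0 ≤ ε * (t - t') := mul_nonneg hε.le (by linarith [ht'.2])
    nlinarith
  nlinarith [mul_le_mul_of_nonneg_left h2 hT.le, h1, h3]

end TimeTaylor

end Literature.Geometry.Riemannian

end
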